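import Literature.MathematicalPhysics.QuantumFieldTheory.Balaban1983to89.Node00.Record13
import HarnessLib

/-!
# BalabanLadder ∕ UV — Track A's output ONE LINE BEFORE the Stage-0 projection, RE-KEYED to the v1.2 SEPARATED-RANGE record (`Provisos₁₃Sep`)

OS-ASSEMBLY BOOKKEEPING (cell `ym-fleet`, seat `ym-osasm-p1`, director-ym R136 (iii); `--supports stmt-QuantumFields-19351` = the spine crux
`Summit.QuantumFields.YangMills.Theses.BalabanLadder.UV`, binder `hUV` of `BalabanLadder.closes`).  DEFINITIONS ONLY (two `Prop`s, parametric in the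
group rank `N`); nothing of Bałaban's is asserted; COUNT-NEUTRAL.  The `Provisos₁₃Sep` twin of `Theorems/BalabanLadderUVRecord13Defs.lean` (p489475):
SAME shapes, tokens re-keyed `Provisos₁₃ ↦ Provisos₁₃Sep`, `datumOfRecord₁₃ ↦ datumOfRecord₁₃Sep`, `IsRecordOfRecord₁₃C ↦ IsRecordOfRecord₁₃CSep`.

WHY.  `Node00/Record13.lean` v1.2 (def-T, DEPRECATE-AND-ADD, director-ym ★★ LINE №136–№138, plan g67 ACK-138): the v1.1 proviso structure `Provisos₁₃`
demands the background row `bg` at EVERY nested sequence of record, separated or not, which is print-STRONGER than [15] Thm 1 (it gives the row only on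
(2.18)-separated sequences) — LOCATED-P11-SEQ.  v1.2 adds the guarded structure `Stage13Params.Provisos₁₃Sep` (support guard via `Sect2.SeqSeparated`),
the datum `Node00.datumOfRecord₁₃Sep`, the record class `Node00.IsRecordOfRecord₁₃CSep`, the one-way maps `Provisos₁₃.toSep` ∕ `IsRecordOfRecord₁₃C.toSep`
and the `rfl` bridge `datumOfRecord₁₃Sep_toSep`; the Track-A detail route `route-QuantumFields-BalabanUVNodes` re-keys its four items to the new proviso name
at rev 18 (the ‴ four 19909–19912 → aside; four ⁗ items; `closes` re-keyed).  This file NAMES the conjunction that re-keyed `closes` holds one line before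
its Stage-0 projection, in the two currencies in use:

* `UVAtParams13Sep N` — θ-keyed: `∀ F, ∃ θ (h : θ.Provisos₁₃Sep F N), (ZtUnity ∧ SlotsNondegenerate₁₃) ∧ Admissible ∧ (B) ∧ window(K ≥ 1) ∧ END ∧ NE7`
  at `Node00.datumOfRecord₁₃Sep F N θ h`;
* `UVAtRecord13CSep N` — (D, w)-keyed: `∀ F, ∃ D w, Node00.IsRecordOfRecord₁₃CSep F N D w ∧ (B) ∧ window(K ≥ 1) ∧ END ∧ NE7`.

The kernels (`Theorems/BalabanLadderUVRecord13Sep.lean`) prove: the four re-keyed texts (`2 ↦ N`, INLINE) ⇒ `UVAtParams13Sep N`; θ ⇒ (D, w); both ⇒ the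
Stage-0 text (at `N = 2` the CURRENT body of `BalabanLadder.UV`); the v1.1 packages ⇒ the v1.2 packages (`Provisos₁₃.toSep`, same datum by `rfl`); the T⁴
apex at the pinned record.  ROUTE-INDEPENDENT BY DESIGN: no `Theses` import, no module in a route's cone.  HONEST FRAMING: names for HYPOTHESES of a
conditional chain (0∕6 spine legs discharged); one finite four-torus programme per family at fixed ε; NOT infinite volume, NOT OS on ℝ⁴, NOT a mass gap,
NOT Clay.
-/

set_option autoImplicit false

namespace Summit.QuantumFields.YangMills.Cruxes.UV.Record13Sep

open Literature.MathematicalPhysics.QuantumFieldTheory.Balaban1983to89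
open Literature.MathematicalPhysics.QuantumFieldTheory.Balaban1983to89.T4Continuum

/-- **TRACK A's UV PACKAGE AT THE PINNED STAGE-13 SEPARATED-RANGE RECORD (v1.2 `Provisos₁₃Sep`), θ-KEYED** (`SU(N)`; the spine's is `N = 2`): on every four-torus family some admissible
Stage-13 parameter tuple `θ` satisfying its displayed provisos `h`, with print's partition of unity and non-degenerate present slots (torus-guarded),
whose datum of record `Node00.datumOfRecord₁₃Sep F N θ h` carries [III]'s end statement (B) as printed, the non-vacuity coupling window with `K ≥ 1`,
endpoint existence of its coupling flow ([I] Thm 2, endpoint half) and the hybrid-NE7 spine under it.  Verbatim the conjunction the detail route's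
rev-18 `closes` holds after feeding K1⁗'s record to K2⁗ and K3⁗ and before projecting to Stage 0.  OPEN as a whole; never asserted. -/
def UVAtParams13Sep (N : ℕ) [NeZero N] : Prop :=
  ∀ F : T4Family, ∃ (θ : Node00.Stage13Params F N) (h : θ.Provisos₁₃Sep F N),
    (θ.ZtUnity F N ∧ θ.SlotsNondegenerate₁₃ F N) ∧ θ.Admissible F N ∧
    B16.EndStatementBPrinted (Node00.datumOfRecord₁₃Sep F N θ h).C ∧
    (∃ γ₁ : ℝ, 0 < γ₁ ∧ ∀ γ : ℝ, 0 < γ → γ ≤ γ₁ →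
      ∃ P : B12.RunParams, 1 ≤ P.K ∧ ((Node00.datumOfRecord₁₃Sep F N θ h).C P).flow.InInterval γ P.K) ∧
    DagBinding.EndpointExistence (Node00.datumOfRecord₁₃Sep F N θ h).C.toB12 ∧
    T4ApexHybrid.HybridNE7Under (Node00.datumOfRecord₁₃Sep F N θ h)
      (DagBinding.EndpointExistence (Node00.datumOfRecord₁₃Sep F N θ h).C.toB12)

/-- **TRACK A's UV PACKAGE AT A STAGE-13 SEPARATED-RANGE RECORD-OF-RECORD (v1.2 `IsRecordOfRecord₁₃CSep`), (D, w)-KEYED** (`SU(N)`): on every four-torus family some finite-ε datum `D` and world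
`w` with `Node00.IsRecordOfRecord₁₃CSep F N D w` («(D, w) is the record, Stage 13»: `D = datumOfRecord₁₃ θ h` for admissible θ with provisos, `w` bound to
its construction), carrying (B) as printed, the `K ≥ 1` coupling window, endpoint existence and the hybrid-NE7 spine.  Implied by `UVAtParams13Sep N`
(the unity ∕ non-degeneracy clause is dropped — the record predicate does not carry it).  OPEN as a whole; never asserted. -/
def UVAtRecord13CSep (N : ℕ) [NeZero N] : Prop :=
  ∀ F : T4Family, ∃ (D : FiniteEpsData F (Matrix.specialUnitaryGroup (Fin N) ℂ)) (w : DagBinding.WorldP),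
    Node00.IsRecordOfRecord₁₃CSep F N D w ∧ B16.EndStatementBPrinted D.C ∧
    (∃ γ₁ : ℝ, 0 < γ₁ ∧ ∀ γ : ℝ, 0 < γ → γ ≤ γ₁ → ∃ P : B12.RunParams, 1 ≤ P.K ∧ (D.C P).flow.InInterval γ P.K) ∧
    DagBinding.EndpointExistence D.C.toB12 ∧
    T4ApexHybrid.HybridNE7Under D (DagBinding.EndpointExistence D.C.toB12)

end Summit.QuantumFields.YangMills.Cruxes.UV.Record13Sep
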